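import Mathlib
import Summits.Ventures.FusionMHD.Models.CerfonFreidbergIterLikeQHalfMercDefs
import HarnessLib

/-!
# Ventures/FusionMHD — Models/CerfonFreidbergIterLikeQHalfMercPanels13.lean: KERNEL CHECK of the Mercier-register certificates of panel(s) 22, 23 (of 32)
# at `ψ_N = 1/2` of THE Cerfon–Freidberg ITER-like instance

HONEST FRAMING (LADDER-GRIDFUSION three columns; CF rung; «F2.R2-CF-MERCIER-IMPLICIT» step (2), F2-SCOPING v1.6 §10(c)).  One `decide +kernel` (≈ 100 s): for each
listed panel the obligation `CFIterLike.QHalfMerc.MercCert.ok` (`Models/CerfonFreidbergIterLikeQHalfMercDefs.lean`) — the Taylor-model run of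
`progM = progA ++ block1 ++ block2 ++ block3M` over ★ #117's parameter box is ACCEPTED (both `inv` certificates included) and the kernel's FOUR panel-integral
enclosures (`g_W`, `g_Aσ`, `g_AR`, `g_B1` along the approximant) lie inside the claimed integers (read off a compiled `#eval` of the same functions, slack one unit of
`2⁻⁶⁰`; float truth inside every panel, `HOME/models/model-7/g7/genqm/truthM.json`).  MODELLED: analytic Cerfon–Freidberg family; nothing about a device or
stability.  No `native_decide`.  Typer/prover: gridfusion-model-7 (g7), 2026-08-27.
Citations: Jardin 2010 §8.5 (8.134) [Jardin2010]; Mahboubi–Melquiond–Sibut-Pinote 2016 §3.2 Lemma 3 [MahboubiMelquiondSibutpinote2016].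
-/

namespace Summit.Ventures.FusionMHD.Models.CFIterLike.QHalfMerc

/-- Mercier-register certificate data of panel(s) 22, 23. [instance data] -/
def mercCert13 : List MercCert := [
  { j := 22, cand1 := [2031168602596235542528, -9611877739688668168192, -12699519640848918642688, 502383215775496290697216, -2898307893849208104419328, 284921959784770487451648, 109989829522833843595247616, -767390678364198160599875584, 1123323987238545131376214016, 21071536078089759809385529344, -188166839274606404205356777472, 459550871679991347767142252544, 6181987795578104851818744905728],
    cand2 := [1345510980228361748480, -8165447669953579712512, 34881148436280565039104, 36685593188411144929280, -2024424228028421955911680, 19513071454824205459128320, -107988685713479243994759168, 203749673584150401301610496, 3001889531584210751698501632, -41324125453323058481440227328, 292733502288683221143154327552, -1055018560034555833464750342144, -2859407020086409570497012432896],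
    deg := 10, e1 := 46, e2 := 45, wlo := 4282211221839766279, whi := 4282211671940837948, slo := 31433396610201902837, shi := 31433398418289658152,
    rlo := 22745932488429327407, rhi := 22745933844462056102, blo := 43443843746994251973, bhi := 43443846157737514250 },
  { j := 23, cand1 := [1731053089240692031488, -9271159285405465968640, 18641350618719581110272, 187352864510902964060160, -1939066182653763500638208, 8473953375524915339329536, -2340213034597462581444608, -241294781508618583155933184, 1839996656742917764766760960, -6271659723907607572523253760, -5188427611844559596205113344, 300932953341633499680041074688, -6391472097718218835260172402688],
    cand2 := [1124081953180703391744, -6049523739177367109632, 31041421979231541264384, -82287993465011120898048, -247910281625816098930688, 5334345372395098874052608, -43536833419549440011665408, 241136546961123908087971840, -855974075727780920789303296, 49213877726695940249616384, 36409996141368794890821959680, -308977048308636901552013967360, -7920127059354654509361222647808],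
    deg := 10, e1 := 45, e2 := 45, wlo := 3160622116809168944, whi := 3160622355322842437, slo := 24119358879232596255, shi := 24119360515256878820,
    rlo := 16895070904870645258, rhi := 16895072083976156083, blo := 34434964199331409389, bhi := 34434966469147853648 }]

/-- **KERNEL CHECK** of the four Mercier registers on panel(s) 22, 23. -/
theorem mercCert13_ok : CFIterLike.QHalfMerc.mercCert13.all MercCert.ok = true := by
  decide +kernel

end Summit.Ventures.FusionMHD.Models.CFIterLike.QHalfMerc
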